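import Literature.MathematicalPhysics.QuantumFieldTheory.Balaban1983to89.B7BlockGeometry

/-!
# T4LoopPullback — the exact LINEAR facts behind the toy rung `θ₁ = L^{1-d}` of node O3c: the transpose of the
straight block average, comb cancellation on closed loops, the pulled-back plaquette as an average of parallel fine
squares, and the per-bond weight bound (cell `pub-balaban`, T4-DAG v5 node O3c, self-proposed kernel row T4-O3c.R1-K\*
of the O3c.R1 lineage; record `t4/T4-RUNG-O3c1.md` §2 (E1)/(E2), §4 V1; kernel bookkeeping, NOT summit progress)

HONEST FRAMING (T4-DAG PAGE 1).  The cell's T4 target is the existence AND uniqueness of the `ε → 0` limit of Bałaban's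
unit-scale averaged loop expectations on a FIXED finite torus — strictly beyond ultraviolet stability
([Balaban1989LargeFieldII] Thm 1 p. 355), NOT infinite volume, NOT a mass gap, NOT the Clay problem.  Row T4-O3c.R1 of
`t4/T4-DAG.md` asked for the per-fine-bond first-derivative rate `θ₁` of the unit loop functional `W_C ∘ avgⁿ` in the
LINEARISED (abelian, angle-unit) model of Bałaban's block averaging, with the printed contour systems.  The record
`t4/T4-RUNG-O3c1.md` v1.0 (unit b2b-balaban-pv25-g4) computed `θ₁ = L^{1-d}` per level EXACTLY in every measured cell
(`d = 4`; `L = 2`, `n ≤ 4`; `L = 3`, `n ≤ 3`; three rational engines) and derived it by hand from two exact facts about the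
linear model: (E1) the comb/contour corrections cancel on CYCLES, so the pull-back of a closed loop does not see the
contour system at all; (E2) the pulled-back plaquette is the average of the `K^d` parallel fine squares of side `K = Lⁿ`
based in one block, whence `|w_b| ≤ K · K^{-d} = K^{1-d}` with equality at the last bond before a block face.  THIS FILE
is the fourth engine: (E1), (E2) and the weight bound PROVED for all `d`, `L`, `n` on the tree's `ℤ^d` block geometry
(`B7BlockGeometry`: `Qav`, `blockSites`, `blockMap`).  Nothing here is an estimate of Bałaban's; it is finite counting.

CITATION HEADER (lean-in-tree rule; the manuscripts are quoted for the DEFINITIONS only — no disputed step is used).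
Renders read as images by the O3c.R1 lineage (b2b-balaban-pv25 gens 3–4) for the record, loci rechecked there:
* B7 = T. Bałaban, *Averaging operations for lattice gauge theories*, Commun. Math. Phys. **98** (1985) 17–51
  [Balaban1985Averaging], p. 19 [render `b2b-balaban-ref1/pages/1985-cmp98-averaging/1985-cmp98-averaging-p003-x2.png`]:
  «For such configurations we demand that (1/i) log Ū is well approximated by the linear averaging operation (1.8)
  defined in [2]. Let us write this operation Ā_c = Σ_{x∈B(c₋)} L^{−(d+1)}(A(Γ_{c₋,x}) + A([x, x(c)]) + A(Γ_{x(c),c₊})).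
  (14) We refer the reader to paper [2] for explanations of symbols used above. Let us notice that
  Γ_{c₋,x}∪[x, x(c)]∪Γ_{x(c),c₊} is an oriented contour with c₋ as an initial point and c₊ as a final point. We denote
  it by Γ_{c,x}.»; «We define Ū_c = exp[i Σ_{x∈B(c₋)} L^{−d} (1/i) log U(Γ_{c,x})U(c)^{−1}] U(c). (15)».
* B5 = T. Bałaban, *Propagators and renormalization transformations for lattice gauge theories. I*, Commun. Math.
  Phys. **95** (1984) 17–40 [Balaban1984PropagatorsI], p. 18 [render
  `…/1984-cmp95-propagators-rt-I/1984-cmp95-propagators-rt-I-p002-x2.png`]: «B(y) = {x ∈ T₁ : y_μ ≤ x_μ < y_μ + L,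
  μ = 1, …, d}, y ∈ T_L^{(1)}. (1.6) In each block B(y) we introduce a family of contours Γ_{y,x} connecting the points
  y and x: Γ_{y,x} = [y, (y₁, …, y_{d−1}, x_d)] ∪ … ∪ [(y₁, …, y_μ, x_{μ+1}, …, x_d), (y₁, …, x_μ, x_{μ+1}, …, x_d)]
  ∪ … ∪ [(y₁, x₂, …, x_d), x], (1.7) where [x₁, x₂] is a line segment connecting points x₁, x₂. We consider Γ_{y,x},
  and all other contours appearing in the paper, as oriented contours, with initial point y and final point x.»;
  p. 19 [render …-p003-x2.png]:
  «B_c = Σ_{x∈B(c₋)} L^{−(d+1)}(A(Γ_{c₋,x}) + A([x, x(c)]) + A(Γ_{x(c),c₊})), c = ⟨c₋, c₊⟩ ⊂ T_L^{(1)}, (1.8) where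
  A(Γ) = Σ_{b⊂Γ} A_b for arbitrary contour Γ, and x(c) denotes a point in the block B(c₊) obtained by translation of x by
  the bond c, so if c = ⟨y, y + Le_μ⟩ then x(c) = x + Le_μ.»; «(QA)_c = Σ_{x∈B(c₋)} L^{−(d+1)}A([x, x(c)]), … (1.11)» —
  the tree's `B7BlockGeometry.Qav M` (weight `M^{-(d+1)}` over the straight segments `[x, x + Me_μ]`, `x ∈ B(c₋)`).
READINGS (the record's, §1; cell readings, NOT print): [Rd2] `Γ_{x(c),c₊}` runs from `x(c)` to `c₊`, i.e. it is the
contour `Γ_{c₊,x(c)}` of the block `B(c₊)` traversed backwards (`A(Γ⁻¹) = −A(Γ)`); [Rd4] ANGLE UNITS: the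
linearisation of (15) at `U = 1` is `θ̄_c = L^{−d} Σ_{x∈B(c₋)} θ(Γ_{c,x})`, i.e. (14)/(1.8) times the coarse bond length
`L` — per fine bond of a contour the weight is `L^{-d}`; the straight part is `L • Qav L` (cf. the sibling
`T4AvgDerivBound`'s docstring: "the flat skeleton ∂Q_k(c)/∂a_b = L^{−kd}·#{x ∈ B^k(c₋) : b ∈ [x, x + L^k e_μ]}").

WHAT THIS FILE PROVES (0 sorry; every statement [folklore] finite counting on `ℤ^d`; `d`, `M`, `K`, `L`, `n` arbitrary):
* §1 chains: the bond indicator `ind b`, the straight segment chain `seg K z μ` (`K` bonds from `z` in direction `μ`),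
  the rectangle boundary `rectBdry K₁ K₂ z μ ν = seg K₁ z μ + seg K₂ (z + K₁e_μ) ν − seg K₁ (z + K₂e_ν) μ − seg K₂ z ν`
  and the square boundary `sqBdry K = rectBdry K K` (the plaquette is `sqBdry 1`, the `1×2` loop `rectBdry 2 1`).
* §2 `pull M` — the TRANSPOSE of the angle-unit straight average: `(pull M γ)(b) = Σ_{l<M} M^{-d} γ(⌊(b₋ − l e_μ)/M⌋, μ)`
  for a coarse chain `γ` and a fine bond `b = (b₋, μ)`; certificate `pull_ind_apply_eq`: its matrix element
  `(pull M [c])(b)` equals `M · (Qav M [b])(c)` — it IS the transpose of `M • Qav M`; `pull_pull`: `pull M (pull K γ)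
  = pull (M K) γ` (the transpose of `B7BlockGeometry.Qav_Qav`, "a composition of k operators Q is Q_k");
  `pull_iterate`: `(pull L)^[n] = pull (Lⁿ)`.
* §3 (E1) COMB CANCELLATION.  For an ARBITRARY assignment `G y x` of a chain to the contour `Γ_{y,x}` (the combs (1.7)
  are NOT modelled — any contour family will do), the contour part of the transpose of (14) on the coarse bond
  `c = ⟨y, y + e_μ⟩`, `Σ_{x∈B_M(y)} M^{-d}(G y x − G (y + e_μ) (x + Me_μ))` ([Rd2], (1.8)), equals `H y − H (y + e_μ)` with
  `H y := Σ_{x∈B_M(y)} M^{-d} G y x` (`contourCorr_eq`, from `sum_blockSites_add_single`: `x ↦ x + Me_μ` maps `B(y)` onto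
  `B(y + e_μ)`); and for every finitely supported coarse chain `Σ_i s_i [e_i]` with ZERO BOUNDARY (`IsCycle`) and every
  `H`, `Σ_i s_i (H (e_i)₋ − H (e_i)₊) = 0` (`corr_eq_zero_of_isCycle`): the contour-corrected pull-back of a closed loop
  equals the straight one (`pullC_eq_pull_of_isCycle`).  Rectangle boundaries are cycles (`isCycle_rect`, via the telescoping `corr_rect_eq_zero`).
* §4 (E2) CLOSED FORM.  `pull_seg`: `pull M (seg K z μ) = M^{-d} Σ_{x∈B_M(z)} seg (M K) x μ` (the `K` coarse segments over
  the translates `B(z) + jMe_μ` concatenate, `sum_range_mul_eq`); `pull_rectBdry`: `pull M ∂Rect_{K₁,K₂}(z) =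
  M^{-d} Σ_{x∈B_M(z)} ∂Rect_{MK₁,MK₂}(x)`; `loopPull_closed`: `(pull L)^[n] ∂Sq₁(y) = K^{-d} Σ_{x∈B_K(y)} ∂Sq_K(x)`,
  `K = Lⁿ` (`sum_blockSites_mul` is not even needed: `pull_iterate` reduces the tower to one shot); `towerC_eq`: the
  same chain results if at EVERY level the straight transpose is replaced by the contour-corrected one with any contour
  systems `G k` (by §3).
* §5 θ₁.  `abs_blockSum_sqBdry_le`: every fine bond carries `|w_b| ≤ K · K^{-d}` in `w = (pull L)^[n] ∂Sq₁(y)` (for a `μ`-bond only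
  the bottom sides (`⌊b_ν/K⌋ = y_ν`) or only the top sides (`⌊b_ν/K⌋ = y_ν + 1`) of the `K^d` squares can contain it, at
  most `K` of either); `blockSum_sqBdry_witness`: equality `w_b = K · K^{-d}` at `b = (K y + (K−1)e_μ, μ)` (`μ ≠ ν`); hence
  `theta1_exact`: `sup_b |w_b| = Lⁿ · L^{-nd}`, which `rate_eq_zpow` rewrites as `L^{(1−d)n}` — V1 of the record,
  `θ₁ = L^{1-d}` PER LEVEL EXACTLY, for all `d`, `L ≥ 1`, `n` (the record's `d = 4` budget arithmetic
  `L⁴θ₁L^{-2} = L^{-1}`, `L⁴θ₁² = L^{-2}` is the sibling `T4PairBirth.supRatio_eq` / `momentRatio_eq`, not restated).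

DIVERGENCE (recorded, not silent).  (F6, as in `T4AvgDerivBound`/`T4AvgSensitivity`) the contour systems `Γ_{y,x}` are
NOT modelled: §3 quantifies over an arbitrary assignment `G`, which contains the printed combs (1.7) with either leg
order ([Rd1]) as instances — (E1) needs no property of the combs.  (ii) Carrier `ℤ^d` in scaled integer coordinates
(`B7BlockGeometry`), free boundary: the pull-back of a finitely supported chain never wraps, exactly PART A of the record;
on a torus of side `N·Lⁿ`, `N ≥ 2`, the same finite sums appear.  (iii) Angle units [Rd4]: `pull M` is the transpose of
`M • Qav M`; the transpose of (14)'s field-unit operator is `M⁻¹ • pull M` plus `M⁻¹ •` the contour part.  (iv) Only the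
LINEAR model: nothing is said about (15)'s logarithms (the record's (E3)/(E4) and §3.3 are not in this file).
VALUE = kernel certificate of the linear toy facts (E1)/(E2)/V1 of `t4/T4-RUNG-O3c1.md` for all parameters; NOT an
estimate of Bałaban's, NOT summit progress, NOT continuum, NOT Clay.
-/

noncomputable section

namespace Literature.MathematicalPhysics.QuantumFieldTheory.Balaban1983to89.T4LoopPullback

open Finset
open Literature.MathematicalPhysics.QuantumLattice (ZdEdge blockMap blockBase blockSites mem_blockSites_iff
  card_blockSites blockMap_one blockMap_blockBase_add_of_lt)
open Literature.MathematicalPhysics.QuantumFieldTheory.Balaban1983to89.B7BlockGeometry (Qav Qav_apply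
  blockMap_apply blockMap_blockMap blockMap_add_single_mul sum_blockSites_add_single sum_range_mul_eq)

variable {d : ℕ}

/-! ## 1. Chains on `ℤ^d`: bond indicators, straight segments, rectangle and square boundaries -/

/-- The indicator 1-chain `[b]` of the (positively oriented) bond `b = ⟨b₋, b₋ + e_μ⟩ = (b₋, μ)`. [folklore] -/
def ind (b : ZdEdge d) : ZdEdge d → ℝ := fun b' => if b' = b then 1 else 0

/-- Unfolding of `ind`. [folklore] -/
@[simp] theorem ind_apply (b b' : ZdEdge d) : ind b b' = if b' = b then 1 else 0 := rfl

/-- The straight segment chain `[z, z + K e_μ]` = the `K` bonds `(z + j e_μ, μ)`, `j < K`, coefficient `1` each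
([2] (1.8): "[x₁, x₂] is a line segment connecting points x₁, x₂"). [folklore] -/
def seg (K : ℕ) (z : Fin d → ℤ) (μ : Fin d) : ZdEdge d → ℝ :=
  fun b => ∑ j ∈ range K, if b = (z + Pi.single μ (j : ℤ), μ) then 1 else 0

/-- Unfolding of `seg`. [folklore] -/
theorem seg_apply (K : ℕ) (z : Fin d → ℤ) (μ : Fin d) (b : ZdEdge d) :
    seg K z μ b = ∑ j ∈ range K, if b = (z + Pi.single μ (j : ℤ), μ) then 1 else 0 := rfl

/-- `seg` as a sum of bond indicators. [folklore] -/
theorem seg_eq_sum_ind (K : ℕ) (z : Fin d → ℤ) (μ : Fin d) :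
    seg K z μ = ∑ j ∈ range K, ind (z + Pi.single μ (j : ℤ), μ) := by
  funext b
  rw [seg_apply, Finset.sum_apply]
  rfl

/-- The oriented boundary of the `K₁ × K₂` rectangle based at `z` in the `(μ, ν)`-plane:
bottom `[z, z + K₁e_μ]` + right `[z + K₁e_μ, z + K₁e_μ + K₂e_ν]` − top − left. [folklore] -/
def rectBdry (K₁ K₂ : ℕ) (z : Fin d → ℤ) (μ ν : Fin d) : ZdEdge d → ℝ :=
  seg K₁ z μ + seg K₂ (z + Pi.single μ (K₁ : ℤ)) ν - seg K₁ (z + Pi.single ν (K₂ : ℤ)) μ - seg K₂ z ν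

/-- The oriented boundary `∂Sq_K(z; μ, ν)` of the square of side `K`; the unit plaquette is `sqBdry 1`. [folklore] -/
def sqBdry (K : ℕ) (z : Fin d → ℤ) (μ ν : Fin d) : ZdEdge d → ℝ := rectBdry K K z μ ν

/-- Unfolding of `sqBdry`. [folklore] -/
theorem sqBdry_eq (K : ℕ) (z : Fin d → ℤ) (μ ν : Fin d) : sqBdry K z μ ν = rectBdry K K z μ ν := rfl

/-- A degenerate "rectangle" with `μ = ν` has zero boundary. [folklore] -/
theorem rectBdry_self (K₁ K₂ : ℕ) (z : Fin d → ℤ) (μ : Fin d) : rectBdry K₁ K₂ z μ μ = 0 := by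
  rw [rectBdry]
  have h : seg K₂ (z + Pi.single μ (K₁ : ℤ)) μ = fun b =>
      ∑ j ∈ range K₂, if b = (z + Pi.single μ ((K₁ : ℤ) + j), μ) then (1 : ℝ) else 0 := by
    funext b; rw [seg_apply]
    simp_rw [add_assoc, ← Pi.single_add]
  have h' : seg K₁ (z + Pi.single μ (K₂ : ℤ)) μ = fun b =>
      ∑ j ∈ range K₁, if b = (z + Pi.single μ ((K₂ : ℤ) + j), μ) then (1 : ℝ) else 0 := by
    funext b; rw [seg_apply]
    simp_rw [add_assoc, ← Pi.single_add]
  -- both `seg K₁ z μ + (shifted K₂)` and `(shifted K₁) + seg K₂ z μ` are the segment of `K₁ + K₂` bonds from `z`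
  have hsum : seg K₁ z μ + seg K₂ (z + Pi.single μ (K₁ : ℤ)) μ =
      seg K₂ z μ + seg K₁ (z + Pi.single μ (K₂ : ℤ)) μ := by
    have key : ∀ A B : ℕ, seg A z μ + seg B (z + Pi.single μ (A : ℤ)) μ = seg (A + B) z μ := by
      intro A B
      funext b
      simp only [Pi.add_apply, seg_apply]
      rw [Finset.sum_range_add]
      congr 1
      refine Finset.sum_congr rfl fun j _ => ?_
      rw [add_assoc, ← Pi.single_add]
      push_cast
      rfl
    rw [key, key, Nat.add_comm]
  funext b
  have := congr_fun hsum b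
  simp only [Pi.add_apply, Pi.sub_apply, Pi.zero_apply] at this ⊢
  linarith

/-! ## 2. `pull M`: the transpose of the angle-unit straight average `M • Qav M` -/

/-- The pull-back (transpose of the angle-unit straight block average at ratio `M`, [Rd4]) of a coarse 1-chain `γ`
to the fine lattice: the fine bond `b = (b₋, μ)` lies on the straight segment `[x, x + Me_μ]` of the coarse bond
`(⌊x/M⌋, μ)` for exactly the `x = b₋ − l e_μ`, `l < M`, each with weight `M^{-d}`. A finite sum for EVERY `γ`. [folklore] -/
def pull (M : ℕ) : (ZdEdge d → ℝ) →ₗ[ℝ] (ZdEdge d → ℝ) where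
  toFun γ b := ∑ l ∈ range M, ((M : ℝ) ^ d)⁻¹ * γ (blockMap M (b.1 - Pi.single b.2 (l : ℤ)), b.2)
  map_add' γ γ' := by
    funext b
    simp only [Pi.add_apply, mul_add, Finset.sum_add_distrib]
  map_smul' a γ := by
    funext b
    simp only [Pi.smul_apply, smul_eq_mul, RingHom.id_apply, Finset.mul_sum]
    exact Finset.sum_congr rfl fun l _ => by ring

/-- Unfolding of `pull`. [folklore] -/
@[simp] theorem pull_apply (M : ℕ) (γ : ZdEdge d → ℝ) (b : ZdEdge d) :
    pull M γ b = ∑ l ∈ range M, ((M : ℝ) ^ d)⁻¹ * γ (blockMap M (b.1 - Pi.single b.2 (l : ℤ)), b.2) := rfl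

/-- The "`x` is determined" count: summing a bond-equation indicator over the base points `x` of a finite set. [folklore] -/
theorem sum_ite_bond_eq (S : Finset (Fin d → ℤ)) (b : ZdEdge d) (v : Fin d → ℤ) (μ : Fin d) :
    ∑ x ∈ S, (if b = (x + v, μ) then (1 : ℝ) else 0) = if b.2 = μ ∧ b.1 - v ∈ S then 1 else 0 := by
  have key : ∀ x, (b = (x + v, μ)) ↔ (b.1 - v = x ∧ b.2 = μ) := by
    intro x
    constructor
    · rintro rfl
      exact ⟨add_sub_cancel_right x v, rfl⟩
    · rintro ⟨hx, hμ⟩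
      refine Prod.ext ?_ hμ
      rw [← hx, sub_add_cancel]
  simp_rw [key]
  by_cases hμ : b.2 = μ
  · simp_rw [hμ, and_true, true_and]
    exact Finset.sum_ite_eq S (b.1 - v) (fun _ => (1 : ℝ))
  · simp [hμ]

/-- TRANSPOSE CERTIFICATE against the tree operator `B7BlockGeometry.Qav` ([2] (1.11) / B7 (139)): the matrix element of
`pull M` between the coarse bond `c` and the fine bond `b` is `M` times that of `Qav M` between `b` and `c` — `pull M` is
the transpose of the angle-unit straight average `M • Qav M`. [folklore] -/
theorem pull_ind_apply_eq (M : ℕ) (hM : 0 < M) (c b : ZdEdge d) :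
    pull M (ind c) b = (M : ℝ) * Qav M (ind b) c := by
  haveI : NeZero M := ⟨hM.ne'⟩
  have hMr : (M : ℝ) ≠ 0 := by exact_mod_cast hM.ne'
  rw [pull_apply, Qav_apply, Finset.sum_comm, Finset.mul_sum]
  refine Finset.sum_congr rfl fun l _ => ?_
  simp only [ind_apply]
  rw [← Finset.mul_sum]
  have h1 : ∑ x ∈ blockSites M c.1, (if (x + Pi.single c.2 (l : ℤ), c.2) = b then (1 : ℝ) else 0) =
      if b.2 = c.2 ∧ b.1 - Pi.single c.2 (l : ℤ) ∈ blockSites M c.1 then 1 else 0 := by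
    rw [← sum_ite_bond_eq]
    exact Finset.sum_congr rfl fun x _ => by simp only [eq_comm]
  rw [h1]
  have h2 : ((blockMap M (b.1 - Pi.single b.2 (l : ℤ)), b.2) = c) ↔
      (b.2 = c.2 ∧ b.1 - Pi.single c.2 (l : ℤ) ∈ blockSites M c.1) := by
    rw [mem_blockSites_iff, Prod.ext_iff]
    constructor
    · rintro ⟨h, hμ⟩
      exact ⟨hμ, by rw [← hμ]; exact h⟩
    · rintro ⟨hμ, h⟩
      exact ⟨by rw [hμ]; exact h, hμ⟩
  simp only [h2]
  split_ifs
  · rw [pow_succ]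
    field_simp
  · simp

/-- A vector identity: `−(l + M l′) e_μ = −l e_μ + M(−l′) e_μ`. [folklore] -/
private theorem sub_single_add (x : Fin d → ℤ) (μ : Fin d) (a b : ℤ) :
    x - Pi.single μ (a + b) = x - Pi.single μ a + Pi.single μ (-b) := by
  rw [Pi.single_add, Pi.single_neg]; abel

/-- COMPOSITION (the transpose of `B7BlockGeometry.Qav_Qav`, "a composition of k operators Q is the operator Q_k",
B7 p. 39): pulling back through ratio `K` and then through ratio `M` is pulling back through ratio `M K`. [folklore] -/
theorem pull_pull (M K : ℕ) (hM : 0 < M) (γ : ZdEdge d → ℝ) : pull M (pull K γ) = pull (M * K) γ := by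
  funext b
  obtain ⟨w, μ⟩ := b
  simp only [pull_apply]
  rw [sum_range_mul_eq _ M K, Finset.sum_comm]
  refine Finset.sum_congr rfl fun l _ => ?_
  rw [Finset.mul_sum]
  refine Finset.sum_congr rfl fun l' _ => ?_
  have hcast : ((l' * M + l : ℕ) : ℤ) = (l : ℤ) + (M : ℤ) * (l' : ℤ) := by push_cast; ring
  rw [hcast, sub_single_add, ← mul_neg, ← blockMap_blockMap M K, blockMap_add_single_mul M hM.ne',
    Pi.single_neg, ← sub_eq_add_neg, Nat.cast_mul, mul_pow, mul_inv]
  ring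

/-- Ratio `1` is the identity. [folklore] -/
@[simp] theorem pull_one (γ : ZdEdge d → ℝ) : pull 1 γ = γ := by
  funext b
  simp [pull_apply]

/-- THE TOWER IS ONE SHOT: `n` successive pull-backs through ratio `L` = one pull-back through ratio `Lⁿ`. [folklore] -/
theorem pull_iterate (L : ℕ) (hL : 0 < L) (n : ℕ) (γ : ZdEdge d → ℝ) :
    (pull L)^[n] γ = pull (L ^ n) γ := by
  induction n generalizing γ with
  | zero => simp
  | succ n ih =>
    rw [Function.iterate_succ_apply, ih, pull_pull _ _ (pow_pos hL n), pow_succ]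

/-! ## 3. (E1) Comb cancellation: contour corrections pair to zero against cycles -/

section Cycles

variable {ι : Type*} {β : Type*} [AddCommGroup β] [Module ℝ β]

/-- The boundary `∂γ` of the finitely supported coarse chain `γ = Σ_{i∈I} s_i [e_i]`, evaluated at the site `v`:
`Σ_i s_i (δ_{(e_i)₊, v} − δ_{(e_i)₋, v})`. [folklore] -/
def bdry (I : Finset ι) (e : ι → ZdEdge d) (s : ι → ℝ) (v : Fin d → ℤ) : ℝ :=
  ∑ i ∈ I, s i * ((if (e i).1 + Pi.single (e i).2 1 = v then 1 else 0) - (if (e i).1 = v then 1 else 0))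

/-- `γ` is a CYCLE (closed): `∂γ = 0`. [folklore] -/
def IsCycle (I : Finset ι) (e : ι → ZdEdge d) (s : ι → ℝ) : Prop := ∀ v, bdry I e s v = 0

/-- The chain `Σ_{i∈I} s_i [e_i]` as a function on bonds. [folklore] -/
def chainOf (I : Finset ι) (e : ι → ZdEdge d) (s : ι → ℝ) : ZdEdge d → ℝ := ∑ i ∈ I, s i • ind (e i)

/-- The CONTOUR CORRECTION of the chain against a site-indexed family `H` (`H y` = the total weighted chain of the
contour system attached to the block of `y`): `Σ_i s_i (H (e_i)₋ − H (e_i)₊)`. [folklore] -/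
def corr (H : (Fin d → ℤ) → β) (I : Finset ι) (e : ι → ZdEdge d) (s : ι → ℝ) : β :=
  ∑ i ∈ I, s i • (H (e i).1 - H ((e i).1 + Pi.single (e i).2 1))

/-- Summation by parts: the contour correction is `−⟨∂γ, H⟩`. [folklore] -/
theorem corr_eq_neg_sum_bdry (H : (Fin d → ℤ) → β) (I : Finset ι) (e : ι → ZdEdge d) (s : ι → ℝ)
    (V : Finset (Fin d → ℤ)) (hV₁ : ∀ i ∈ I, (e i).1 ∈ V) (hV₂ : ∀ i ∈ I, (e i).1 + Pi.single (e i).2 1 ∈ V) :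
    corr H I e s = -∑ v ∈ V, bdry I e s v • H v := by
  have expand : ∀ w ∈ V, H w = ∑ v ∈ V, (if w = v then (1 : ℝ) else 0) • H v := by
    intro w hw
    simp_rw [ite_smul, one_smul, zero_smul]
    rw [Finset.sum_ite_eq]
    simp [hw]
  have h1 : ∑ i ∈ I, s i • H (e i).1 = ∑ v ∈ V, (∑ i ∈ I, s i * (if (e i).1 = v then 1 else 0)) • H v := by
    simp_rw [Finset.sum_smul, mul_smul]
    rw [Finset.sum_comm]
    refine Finset.sum_congr rfl fun i hi => ?_
    rw [← Finset.smul_sum, ← expand _ (hV₁ i hi)]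
  have h2 : ∑ i ∈ I, s i • H ((e i).1 + Pi.single (e i).2 1) =
      ∑ v ∈ V, (∑ i ∈ I, s i * (if (e i).1 + Pi.single (e i).2 1 = v then 1 else 0)) • H v := by
    simp_rw [Finset.sum_smul, mul_smul]
    rw [Finset.sum_comm]
    refine Finset.sum_congr rfl fun i hi => ?_
    rw [← Finset.smul_sum, ← expand _ (hV₂ i hi)]
  unfold corr bdry
  simp_rw [smul_sub, Finset.sum_sub_distrib, h1, h2, mul_sub, Finset.sum_sub_distrib, sub_smul,
    Finset.sum_sub_distrib]
  abel

/-- (E1) COMB CANCELLATION FOR CYCLES: a closed coarse chain does not see the contour systems — for EVERY family `H`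
the contour correction vanishes. [folklore] -/
theorem corr_eq_zero_of_isCycle (H : (Fin d → ℤ) → β) {I : Finset ι} {e : ι → ZdEdge d} {s : ι → ℝ}
    (h : IsCycle I e s) : corr H I e s = 0 := by
  classical
  rw [corr_eq_neg_sum_bdry H I e s (I.image (fun i => (e i).1) ∪ I.image (fun i => (e i).1 + Pi.single (e i).2 1))
    (fun i hi => Finset.mem_union_left _ (Finset.mem_image_of_mem _ hi))
    (fun i hi => Finset.mem_union_right _ (Finset.mem_image_of_mem (fun i => (e i).1 + Pi.single (e i).2 1) hi))]
  simp [h _]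

/-- Conversely the boundary is read off the correction against site indicators: `IsCycle` ⟺ `corr δ = 0`. [folklore] -/
theorem bdry_eq_neg_corr_ind (I : Finset ι) (e : ι → ZdEdge d) (s : ι → ℝ) (v : Fin d → ℤ) :
    bdry I e s v = -corr (fun y : Fin d → ℤ => fun v' : Fin d → ℤ => if y = v' then (1 : ℝ) else 0) I e s v := by
  unfold bdry corr
  rw [Finset.sum_apply, ← Finset.sum_neg_distrib]
  refine Finset.sum_congr rfl fun i _ => ?_
  simp only [Pi.smul_apply, Pi.sub_apply, smul_eq_mul]
  ring

end Cycles

/-- B7 (14) with [Rd2] and (1.8): the contour of the coarse bond `c = ⟨y, y + e_μ⟩` at `x ∈ B_M(y)` is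
`Γ_{y,x} ∪ [x, x + Me_μ] ∪ (Γ_{y+e_μ, x+Me_μ})⁻¹`. For an ARBITRARY assignment `G y x` (:= the chain of `Γ_{y,x}`; the
combs (1.7) are one instance, NOT modelled) the contour-system part of the transpose of the angle-unit average on `c` is
this chain. [folklore] -/
def contourCorr {β : Type*} [AddCommGroup β] [Module ℝ β] (M : ℕ) (G : (Fin d → ℤ) → (Fin d → ℤ) → β)
    (c : ZdEdge d) : β :=
  ∑ x ∈ blockSites M c.1, ((M : ℝ) ^ d)⁻¹ • (G c.1 x - G (c.1 + Pi.single c.2 1) (x + Pi.single c.2 (M : ℤ)))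

/-- `H y := Σ_{x∈B_M(y)} M^{-d} G y x` — the block's total weighted contour chain. [folklore] -/
def combChain {β : Type*} [AddCommGroup β] [Module ℝ β] (M : ℕ) (G : (Fin d → ℤ) → (Fin d → ℤ) → β)
    (y : Fin d → ℤ) : β :=
  ∑ x ∈ blockSites M y, ((M : ℝ) ^ d)⁻¹ • G y x

/-- The contour part on `c` is the DIFFERENCE `H(c₋) − H(c₊)`: `x ↦ x(c) = x + Me_μ` maps `B(c₋)` onto `B(c₊)` ((1.8);
`sum_blockSites_add_single`). [folklore] -/
theorem contourCorr_eq {β : Type*} [AddCommGroup β] [Module ℝ β] (M : ℕ) (hM : 0 < M)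
    (G : (Fin d → ℤ) → (Fin d → ℤ) → β) (c : ZdEdge d) :
    contourCorr M G c = combChain M G c.1 - combChain M G (c.1 + Pi.single c.2 1) := by
  unfold contourCorr combChain
  rw [sum_blockSites_add_single M hM c.1 c.2 1, mul_one]
  simp_rw [smul_sub, Finset.sum_sub_distrib]

/-- The CONTOUR-CORRECTED pull-back of the chain `Σ_i s_i [e_i]`: straight part `pull M`, plus the contour parts. [folklore] -/
def pullC (M : ℕ) (G : (Fin d → ℤ) → (Fin d → ℤ) → (ZdEdge d → ℝ)) {ι : Type*} (I : Finset ι)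
    (e : ι → ZdEdge d) (s : ι → ℝ) : ZdEdge d → ℝ :=
  pull M (chainOf I e s) + ∑ i ∈ I, s i • contourCorr M G (e i)

/-- The contour parts of `pullC` assemble into the correction `corr` against the block chains `H = combChain M G`. [folklore] -/
theorem pullC_eq_pull_add_corr (M : ℕ) (hM : 0 < M) (G : (Fin d → ℤ) → (Fin d → ℤ) → (ZdEdge d → ℝ))
    {ι : Type*} (I : Finset ι) (e : ι → ZdEdge d) (s : ι → ℝ) :
    pullC M G I e s = pull M (chainOf I e s) + corr (combChain M G) I e s := by
  unfold pullC corr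
  simp_rw [contourCorr_eq M hM]

/-- (E1) AT THE LEVEL OF THE AVERAGING OPERATION: for a closed coarse chain the contour-corrected pull-back through
(14) equals the straight pull-back through (1.11) — whatever the contour systems. [folklore] -/
theorem pullC_eq_pull_of_isCycle (M : ℕ) (hM : 0 < M) (G : (Fin d → ℤ) → (Fin d → ℤ) → (ZdEdge d → ℝ))
    {ι : Type*} {I : Finset ι} {e : ι → ZdEdge d} {s : ι → ℝ} (h : IsCycle I e s) :
    pullC M G I e s = pull M (chainOf I e s) := by
  rw [pullC_eq_pull_add_corr M hM, corr_eq_zero_of_isCycle _ h, add_zero]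

/-! ### Rectangle boundaries as indexed chains; they are cycles -/

/-- The `2(K₁ + K₂)` oriented bonds of `∂Rect_{K₁,K₂}(z; μ, ν)` indexed by (side, position): side `0` bottom,
`1` right, `2` top, `3` left. [folklore] -/
def rectE (K₁ K₂ : ℕ) (z : Fin d → ℤ) (μ ν : Fin d) : Fin 4 × ℕ → ZdEdge d := fun p =>
  ![(z + Pi.single μ (p.2 : ℤ), μ),
    (z + Pi.single μ (K₁ : ℤ) + Pi.single ν (p.2 : ℤ), ν),
    (z + Pi.single ν (K₂ : ℤ) + Pi.single μ (p.2 : ℤ), μ),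
    (z + Pi.single ν (p.2 : ℤ), ν)] p.1

/-- Signs: bottom and right `+1`, top and left `−1`. [folklore] -/
def rectS : Fin 4 × ℕ → ℝ := fun p => ![1, 1, -1, -1] p.1

/-- Index set: side lengths `K₁, K₂, K₁, K₂`. [folklore] -/
def rectI (K₁ K₂ : ℕ) : Finset (Fin 4 × ℕ) :=
  ({0} : Finset (Fin 4)) ×ˢ range K₁ ∪ ({1} : Finset (Fin 4)) ×ˢ range K₂ ∪
    ({2} : Finset (Fin 4)) ×ˢ range K₁ ∪ ({3} : Finset (Fin 4)) ×ˢ range K₂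

/-- Sums over `rectI` split into the four sides. [folklore] -/
theorem sum_rectI {γ : Type*} [AddCommMonoid γ] (K₁ K₂ : ℕ) (f : Fin 4 × ℕ → γ) :
    ∑ p ∈ rectI K₁ K₂, f p = ∑ j ∈ range K₁, f (0, j) + ∑ j ∈ range K₂, f (1, j) +
      ∑ j ∈ range K₁, f (2, j) + ∑ j ∈ range K₂, f (3, j) := by
  unfold rectI
  have hd : ∀ (a b : Fin 4) (A B : ℕ), a ≠ b →
      Disjoint (({a} : Finset (Fin 4)) ×ˢ range A) (({b} : Finset (Fin 4)) ×ˢ range B) := by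
    intro a b A B hab
    rw [Finset.disjoint_left]
    rintro ⟨i, j⟩ h h'
    simp only [Finset.mem_product, Finset.mem_singleton] at h h'
    exact hab (h.1.symm.trans h'.1)
  rw [Finset.sum_union, Finset.sum_union, Finset.sum_union]
  · simp only [Finset.sum_product, Finset.sum_singleton]
  · exact hd 0 1 _ _ (by decide)
  · rw [Finset.disjoint_union_left]
    exact ⟨hd 0 2 _ _ (by decide), hd 1 2 _ _ (by decide)⟩
  · rw [Finset.disjoint_union_left, Finset.disjoint_union_left]
    exact ⟨⟨hd 0 3 _ _ (by decide), hd 1 3 _ _ (by decide)⟩, hd 2 3 _ _ (by decide)⟩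

/-- The indexed chain IS the rectangle boundary of §1. [folklore] -/
theorem chainOf_rect (K₁ K₂ : ℕ) (z : Fin d → ℤ) (μ ν : Fin d) :
    chainOf (rectI K₁ K₂) (rectE K₁ K₂ z μ ν) rectS = rectBdry K₁ K₂ z μ ν := by
  unfold chainOf rectBdry
  rw [sum_rectI]
  simp only [rectE, rectS, Matrix.cons_val_zero, Matrix.cons_val_one, Matrix.head_cons,
    Matrix.cons_val_two, Matrix.tail_cons, Matrix.cons_val_three, one_smul, neg_smul,
    Finset.sum_neg_distrib, seg_eq_sum_ind]
  abel

/-- (E1) FOR RECTANGLES, directly: the contour correction of `∂Rect` telescopes side by side and the four corner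
terms cancel — for every `H`. [folklore] -/
theorem corr_rect_eq_zero {β : Type*} [AddCommGroup β] [Module ℝ β] (H : (Fin d → ℤ) → β) (K₁ K₂ : ℕ)
    (z : Fin d → ℤ) (μ ν : Fin d) : corr H (rectI K₁ K₂) (rectE K₁ K₂ z μ ν) rectS = 0 := by
  unfold corr
  rw [sum_rectI]
  simp only [rectE, rectS, Matrix.cons_val_zero, Matrix.cons_val_one, Matrix.head_cons,
    Matrix.cons_val_two, Matrix.tail_cons, Matrix.cons_val_three, one_smul, neg_smul, Finset.sum_neg_distrib]
  have tele : ∀ (A : ℕ) (w : Fin d → ℤ) (κ : Fin d),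
      ∑ j ∈ range A, (H (w + Pi.single κ (j : ℤ)) - H (w + Pi.single κ (j : ℤ) + Pi.single κ 1)) =
        H w - H (w + Pi.single κ (A : ℤ)) := by
    intro A w κ
    have := Finset.sum_range_sub' (fun j : ℕ => H (w + Pi.single κ (j : ℤ))) A
    simp only [Nat.cast_zero, Pi.single_zero, add_zero] at this
    rw [← this]
    refine Finset.sum_congr rfl fun j _ => ?_
    rw [add_assoc, ← Pi.single_add, Nat.cast_succ]
  rw [tele, tele, tele, tele, add_right_comm z (Pi.single ν (K₂ : ℤ)) (Pi.single μ (K₁ : ℤ))]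
  abel

/-- Rectangle boundaries are CYCLES (`∂∂ = 0`). [folklore] -/
theorem isCycle_rect (K₁ K₂ : ℕ) (z : Fin d → ℤ) (μ ν : Fin d) :
    IsCycle (rectI K₁ K₂) (rectE K₁ K₂ z μ ν) rectS := by
  intro v
  rw [bdry_eq_neg_corr_ind, corr_rect_eq_zero]
  simp

/-- Hence: the contour-corrected pull-back of a rectangle boundary is its straight pull-back, for any contour systems
`G` — the loop does not see the combs. [folklore] -/
theorem pullC_rect (M : ℕ) (hM : 0 < M) (G : (Fin d → ℤ) → (Fin d → ℤ) → (ZdEdge d → ℝ)) (K₁ K₂ : ℕ)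
    (z : Fin d → ℤ) (μ ν : Fin d) :
    pullC M G (rectI K₁ K₂) (rectE K₁ K₂ z μ ν) rectS = pull M (rectBdry K₁ K₂ z μ ν) := by
  rw [pullC_eq_pull_of_isCycle M hM G (isCycle_rect K₁ K₂ z μ ν), chainOf_rect]

/-! ## 4. (E2) The pulled-back loop is an average of parallel fine rectangles -/

/-- The straight pull-back of ONE coarse bond `(w, μ)`: `M^{-d}` times the `M^d` parallel fine segments of its block. [folklore] -/
theorem pull_ind (M : ℕ) (hM : 0 < M) (w : Fin d → ℤ) (μ : Fin d) :
    pull M (ind (w, μ)) = ((M : ℝ) ^ d)⁻¹ • ∑ x ∈ blockSites M w, seg M x μ := by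
  haveI : NeZero M := ⟨hM.ne'⟩
  funext b
  rw [pull_apply, Pi.smul_apply, Finset.sum_apply, smul_eq_mul]
  simp only [seg_apply, ind_apply]
  rw [Finset.sum_comm, Finset.mul_sum]
  refine Finset.sum_congr rfl fun l _ => ?_
  rw [sum_ite_bond_eq]
  congr 1
  have : ((blockMap M (b.1 - Pi.single b.2 (l : ℤ)), b.2) = (w, μ)) ↔
      (b.2 = μ ∧ b.1 - Pi.single μ (l : ℤ) ∈ blockSites M w) := by
    rw [mem_blockSites_iff, Prod.mk.injEq]
    constructor
    · rintro ⟨h, hμ⟩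
      exact ⟨hμ, by rw [← hμ]; exact h⟩
    · rintro ⟨hμ, h⟩
      exact ⟨by rw [hμ]; exact h, hμ⟩
  simp only [this]

/-- `K` consecutive segments of `M` bonds through the translates `x + jMe_μ` form the segment of `M K` bonds. [folklore] -/
theorem sum_seg_translate (M K : ℕ) (x : Fin d → ℤ) (μ : Fin d) :
    ∑ j ∈ range K, seg M (x + Pi.single μ ((M : ℤ) * j)) μ = seg (M * K) x μ := by
  funext b
  rw [Finset.sum_apply, seg_apply, sum_range_mul_eq _ M K]
  refine Finset.sum_congr rfl fun j _ => ?_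
  rw [seg_apply]
  refine Finset.sum_congr rfl fun l _ => ?_
  have : x + Pi.single μ ((M : ℤ) * j) + Pi.single μ (l : ℤ) = x + Pi.single μ ((j * M + l : ℕ) : ℤ) := by
    rw [add_assoc, ← Pi.single_add]
    push_cast
    ring_nf
  rw [this]

/-- (E2) FOR A SEGMENT: `pull M [z, z + Ke_μ] = M^{-d} Σ_{x∈B_M(z)} [x, x + MKe_μ]`. [folklore] -/
theorem pull_seg (M : ℕ) (hM : 0 < M) (K : ℕ) (z : Fin d → ℤ) (μ : Fin d) :
    pull M (seg K z μ) = ((M : ℝ) ^ d)⁻¹ • ∑ x ∈ blockSites M z, seg (M * K) x μ := by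
  rw [seg_eq_sum_ind, map_sum]
  simp_rw [pull_ind M hM]
  rw [← Finset.smul_sum]
  congr 1
  simp_rw [sum_blockSites_add_single M hM z μ]
  rw [Finset.sum_comm]
  refine Finset.sum_congr rfl fun x _ => ?_
  exact sum_seg_translate M K x μ

/-- (E2) FOR A RECTANGLE: the straight pull-back of `∂Rect_{K₁,K₂}(z)` at ratio `M` is `M^{-d}` times the sum of the
boundaries of the `M^d` parallel fine rectangles `Rect_{MK₁,MK₂}(x)`, `x ∈ B_M(z)`. [folklore] -/
theorem pull_rectBdry (M : ℕ) (hM : 0 < M) (K₁ K₂ : ℕ) (z : Fin d → ℤ) (μ ν : Fin d) :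
    pull M (rectBdry K₁ K₂ z μ ν) =
      ((M : ℝ) ^ d)⁻¹ • ∑ x ∈ blockSites M z, rectBdry (M * K₁) (M * K₂) x μ ν := by
  unfold rectBdry
  rw [map_sub, map_sub, map_add, pull_seg M hM, pull_seg M hM, pull_seg M hM, pull_seg M hM,
    sum_blockSites_add_single M hM z μ, sum_blockSites_add_single M hM z ν]
  simp only [← smul_add, ← smul_sub, ← Finset.sum_add_distrib, ← Finset.sum_sub_distrib]
  push_cast
  rfl

/-- THE PULLED-BACK PLAQUETTE (record §2 (E2)): `(pull L)^[n] ∂Sq₁(y) = K^{-d} Σ_{x∈B_K(y)} ∂Sq_K(x)`, `K = Lⁿ` — the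
average of the `K^d` parallel fine squares of side `K` based in the block of `y`. [folklore] -/
theorem loopPull_closed (L : ℕ) (hL : 0 < L) (n : ℕ) (y : Fin d → ℤ) (μ ν : Fin d) :
    (pull L)^[n] (sqBdry 1 y μ ν) =
      (((L ^ n : ℕ) : ℝ) ^ d)⁻¹ • ∑ x ∈ blockSites (L ^ n) y, sqBdry (L ^ n) x μ ν := by
  rw [pull_iterate L hL, sqBdry_eq, pull_rectBdry _ (pow_pos hL n), mul_one]
  rfl

/-- Same for the `K₁ × K₂` loop (e.g. the record's `1 × 2` rectangle `rectBdry 2 1`). [folklore] -/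
theorem rectPull_closed (L : ℕ) (hL : 0 < L) (n K₁ K₂ : ℕ) (y : Fin d → ℤ) (μ ν : Fin d) :
    (pull L)^[n] (rectBdry K₁ K₂ y μ ν) =
      (((L ^ n : ℕ) : ℝ) ^ d)⁻¹ • ∑ x ∈ blockSites (L ^ n) y, rectBdry (L ^ n * K₁) (L ^ n * K₂) x μ ν := by
  rw [pull_iterate L hL, pull_rectBdry _ (pow_pos hL n)]

/-- The tower WITH CONTOUR CORRECTIONS at every level (any contour systems `G k` at level `k`): level `0` is the unit
plaquette on the top lattice; the level-`k` chain, written as the combination `L^{-kd} Σ_{x∈B_{L^k}(y)} ∂Sq_{L^k}(x)`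
(which it is, `towerC_eq`), is pulled back one more level through (14) = straight part + contour parts. [folklore] -/
def towerC (G : ℕ → (Fin d → ℤ) → (Fin d → ℤ) → (ZdEdge d → ℝ)) (L : ℕ) (y : Fin d → ℤ) (μ ν : Fin d) :
    ℕ → (ZdEdge d → ℝ)
  | 0 => sqBdry 1 y μ ν
  | k + 1 => (((L ^ k : ℕ) : ℝ) ^ d)⁻¹ •
      ∑ x ∈ blockSites (L ^ k) y, pullC L (G k) (rectI (L ^ k) (L ^ k)) (rectE (L ^ k) (L ^ k) x μ ν) rectS

/-- (E1) + (E2): the contour-corrected tower equals the straight tower `(pull L)^[k] ∂Sq₁(y)` at every level, for ANY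
contour systems — `F_n = (Q₀ᵀ ⋯ Q_{n−1}ᵀ) ∂C` in the record's words. [folklore] -/
theorem towerC_eq (G : ℕ → (Fin d → ℤ) → (Fin d → ℤ) → (ZdEdge d → ℝ)) (L : ℕ) (hL : 0 < L)
    (y : Fin d → ℤ) (μ ν : Fin d) (k : ℕ) : towerC G L y μ ν k = (pull L)^[k] (sqBdry 1 y μ ν) := by
  cases k with
  | zero => rfl
  | succ k =>
    rw [towerC, Function.iterate_succ_apply', loopPull_closed L hL k y μ ν, map_smul, map_sum]
    congr 1
    exact Finset.sum_congr rfl fun x _ => pullC_rect L hL (G k) _ _ x μ ν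

/-! ## 5. θ₁: the per-bond weights of the pulled-back plaquette -/

/-- Evaluation of a block-sum of translated segments at a bond: the base point is determined, one indicator per
longitudinal position. [folklore] -/
theorem sum_seg_apply (K : ℕ) (S : Finset (Fin d → ℤ)) (v : Fin d → ℤ) (μ : Fin d) (b : ZdEdge d) :
    (∑ x ∈ S, seg K (x + v) μ) b =
      ∑ l ∈ range K, if b.2 = μ ∧ b.1 - v - Pi.single μ (l : ℤ) ∈ S then (1 : ℝ) else 0 := by
  rw [Finset.sum_apply]
  simp only [seg_apply]
  rw [Finset.sum_comm]
  refine Finset.sum_congr rfl fun l _ => ?_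
  have h := sum_ite_bond_eq S b (v + Pi.single μ (l : ℤ)) μ
  rw [sub_sub, ← h]
  simp_rw [add_assoc]

/-- A sum of `K` indicators lies in `[0, K]`. [folklore] -/
private theorem sum_ite_range_nonneg_le (K : ℕ) (P : ℕ → Prop) [DecidablePred P] :
    0 ≤ ∑ l ∈ range K, (if P l then (1 : ℝ) else 0) ∧ ∑ l ∈ range K, (if P l then (1 : ℝ) else 0) ≤ K := by
  constructor
  · exact Finset.sum_nonneg fun l _ => by split_ifs <;> norm_num
  · calc ∑ l ∈ range K, (if P l then (1 : ℝ) else 0) ≤ ∑ _l ∈ range K, (1 : ℝ) :=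
          Finset.sum_le_sum fun l _ => by split_ifs <;> norm_num
      _ = K := by simp

/-- The `ν`-th block coordinate separates bottom sides from top sides: a base point of a bottom side has
`⌊b_ν/K⌋ = y_ν`, of a top side `⌊b_ν/K⌋ = y_ν + 1` (`μ ≠ ν`). [folklore] -/
private theorem blockCoord_of_mem {K : ℕ} [NeZero K] {y w : Fin d → ℤ} {μ ν : Fin d} (hμν : μ ≠ ν) {l : ℤ}
    (t : ℤ) (h : w - Pi.single ν ((K : ℤ) * t) - Pi.single μ l ∈ blockSites K y) :
    w ν / (K : ℤ) = y ν + t := by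
  have hK : (K : ℤ) ≠ 0 := by exact_mod_cast NeZero.ne K
  rw [mem_blockSites_iff] at h
  have := congr_fun h ν
  rw [blockMap_apply] at this
  simp only [Pi.sub_apply, Pi.single_eq_same, Pi.single_eq_of_ne hμν.symm, sub_zero] at this
  have e : w ν - (K : ℤ) * t = w ν + (K : ℤ) * (-t) := by ring
  rw [e, Int.add_mul_ediv_left _ _ hK] at this
  omega

/-- θ₁ UPPER BOUND (record (E2): "`|w_b| = K^{-d}·tent_K ≤ K^{1-d}`"): every fine bond carries weight at most
`K · K^{-d}` in the pulled-back plaquette `K^{-d} Σ_{x∈B_K(y)} ∂Sq_K(x)`. [folklore] -/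
theorem abs_blockSum_sqBdry_le (K : ℕ) (hK : 0 < K) (y : Fin d → ℤ) (μ ν : Fin d) (b : ZdEdge d) :
    |(((K : ℝ) ^ d)⁻¹ • ∑ x ∈ blockSites K y, sqBdry K x μ ν) b| ≤ (K : ℝ) * ((K : ℝ) ^ d)⁻¹ := by
  haveI : NeZero K := ⟨hK.ne'⟩
  have hKd : (0 : ℝ) < ((K : ℝ) ^ d)⁻¹ := inv_pos.2 (pow_pos (by exact_mod_cast hK) d)
  by_cases hμν : μ = ν
  · subst hμν
    simp only [sqBdry_eq, rectBdry_self, Finset.sum_const_zero, smul_zero, Pi.zero_apply, abs_zero]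
    exact mul_nonneg (Nat.cast_nonneg K) hKd.le
  rw [Pi.smul_apply, smul_eq_mul, abs_mul, abs_of_pos hKd, mul_comm]
  refine mul_le_mul_of_nonneg_right ?_ hKd.le
  -- the four side counts
  have split : (∑ x ∈ blockSites K y, sqBdry K x μ ν) b =
      (∑ x ∈ blockSites K y, seg K (x + 0) μ) b + (∑ x ∈ blockSites K y, seg K (x + Pi.single μ (K : ℤ)) ν) b -
        (∑ x ∈ blockSites K y, seg K (x + Pi.single ν (K : ℤ)) μ) b - (∑ x ∈ blockSites K y, seg K (x + 0) ν) b := by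
    simp only [sqBdry_eq, rectBdry, add_zero, Finset.sum_apply, Pi.add_apply, Pi.sub_apply,
      Finset.sum_add_distrib, Finset.sum_sub_distrib]
  rw [split, sum_seg_apply, sum_seg_apply, sum_seg_apply, sum_seg_apply]
  simp only [sub_zero]
  -- name the four counts
  set A₀ := ∑ l ∈ range K, (if b.2 = μ ∧ b.1 - Pi.single μ (l : ℤ) ∈ blockSites K y then (1 : ℝ) else 0) with hA₀
  set A₁ := ∑ l ∈ range K,
    (if b.2 = ν ∧ b.1 - Pi.single μ (K : ℤ) - Pi.single ν (l : ℤ) ∈ blockSites K y then (1 : ℝ) else 0) with hA₁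
  set A₂ := ∑ l ∈ range K,
    (if b.2 = μ ∧ b.1 - Pi.single ν (K : ℤ) - Pi.single μ (l : ℤ) ∈ blockSites K y then (1 : ℝ) else 0) with hA₂
  set A₃ := ∑ l ∈ range K, (if b.2 = ν ∧ b.1 - Pi.single ν (l : ℤ) ∈ blockSites K y then (1 : ℝ) else 0) with hA₃
  obtain ⟨h0l, h0u⟩ := sum_ite_range_nonneg_le K (fun l => b.2 = μ ∧ b.1 - Pi.single μ (l : ℤ) ∈ blockSites K y)
  obtain ⟨h1l, h1u⟩ := sum_ite_range_nonneg_le K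
    (fun l => b.2 = ν ∧ b.1 - Pi.single μ (K : ℤ) - Pi.single ν (l : ℤ) ∈ blockSites K y)
  obtain ⟨h2l, h2u⟩ := sum_ite_range_nonneg_le K
    (fun l => b.2 = μ ∧ b.1 - Pi.single ν (K : ℤ) - Pi.single μ (l : ℤ) ∈ blockSites K y)
  obtain ⟨h3l, h3u⟩ := sum_ite_range_nonneg_le K (fun l => b.2 = ν ∧ b.1 - Pi.single ν (l : ℤ) ∈ blockSites K y)
  rw [← hA₀] at h0l h0u
  rw [← hA₁] at h1l h1u
  rw [← hA₂] at h2l h2u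
  rw [← hA₃] at h3l h3u
  by_cases hb : b.2 = μ
  · -- a `μ`-bond: only bottom (`A₀`) and top (`A₂`) sides, and not both
    have hA₁0 : A₁ = 0 := Finset.sum_eq_zero fun l _ => by
      rw [if_neg]; rintro ⟨h, _⟩; exact hμν (hb.symm.trans h)
    have hA₃0 : A₃ = 0 := Finset.sum_eq_zero fun l _ => by
      rw [if_neg]; rintro ⟨h, _⟩; exact hμν (hb.symm.trans h)
    have excl : A₀ = 0 ∨ A₂ = 0 := by
      by_contra hcon
      rw [not_or] at hcon
      obtain ⟨l₀, _, hl₀⟩ := Finset.exists_ne_zero_of_sum_ne_zero hcon.1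
      obtain ⟨l₂, _, hl₂⟩ := Finset.exists_ne_zero_of_sum_ne_zero hcon.2
      rw [Ne, ite_eq_right_iff, Classical.not_imp] at hl₀ hl₂
      have e0 : b.1 - Pi.single μ (l₀ : ℤ) = b.1 - Pi.single ν ((K : ℤ) * 0) - Pi.single μ (l₀ : ℤ) := by
        simp
      have e2 : b.1 - Pi.single ν (K : ℤ) - Pi.single μ (l₂ : ℤ) =
          b.1 - Pi.single ν ((K : ℤ) * 1) - Pi.single μ (l₂ : ℤ) := by simp
      have q0 := blockCoord_of_mem (K := K) hμν 0 (e0 ▸ hl₀.1.2)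
      have q2 := blockCoord_of_mem (K := K) hμν 1 (e2 ▸ hl₂.1.2)
      omega
    rw [hA₁0, hA₃0]
    rcases excl with h | h <;> rw [h, abs_le] <;> constructor <;> linarith
  · by_cases hb' : b.2 = ν
    · -- a `ν`-bond: only right (`A₁`) and left (`A₃`) sides, and not both
      have hA₀0 : A₀ = 0 := Finset.sum_eq_zero fun l _ => by
        rw [if_neg]; rintro ⟨h, _⟩; exact hb h
      have hA₂0 : A₂ = 0 := Finset.sum_eq_zero fun l _ => by
        rw [if_neg]; rintro ⟨h, _⟩; exact hb h
      have excl : A₁ = 0 ∨ A₃ = 0 := by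
        by_contra hcon
        rw [not_or] at hcon
        obtain ⟨l₁, _, hl₁⟩ := Finset.exists_ne_zero_of_sum_ne_zero hcon.1
        obtain ⟨l₃, _, hl₃⟩ := Finset.exists_ne_zero_of_sum_ne_zero hcon.2
        rw [Ne, ite_eq_right_iff, Classical.not_imp] at hl₁ hl₃
        have e1 : b.1 - Pi.single μ (K : ℤ) - Pi.single ν (l₁ : ℤ) =
            b.1 - Pi.single μ ((K : ℤ) * 1) - Pi.single ν (l₁ : ℤ) := by simp
        have e3 : b.1 - Pi.single ν (l₃ : ℤ) = b.1 - Pi.single μ ((K : ℤ) * 0) - Pi.single ν (l₃ : ℤ) := by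
          simp
        have q1 := blockCoord_of_mem (K := K) (Ne.symm hμν) 1 (e1 ▸ hl₁.1.2)
        have q3 := blockCoord_of_mem (K := K) (Ne.symm hμν) 0 (e3 ▸ hl₃.1.2)
        omega
      rw [hA₀0, hA₂0]
      rcases excl with h | h <;> rw [h, abs_le] <;> constructor <;> linarith
    · -- neither: all four counts vanish
      have hA₀0 : A₀ = 0 := Finset.sum_eq_zero fun l _ => by rw [if_neg]; rintro ⟨h, _⟩; exact hb h
      have hA₁0 : A₁ = 0 := Finset.sum_eq_zero fun l _ => by rw [if_neg]; rintro ⟨h, _⟩; exact hb' h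
      have hA₂0 : A₂ = 0 := Finset.sum_eq_zero fun l _ => by rw [if_neg]; rintro ⟨h, _⟩; exact hb h
      have hA₃0 : A₃ = 0 := Finset.sum_eq_zero fun l _ => by rw [if_neg]; rintro ⟨h, _⟩; exact hb' h
      rw [hA₀0, hA₁0, hA₂0, hA₃0]
      simp

/-- θ₁ IS ATTAINED (record (E2): "attained on every line of the column at longitudinal position K−1, the last fine
bond before the block face"): at `b = (K y + (K−1)e_μ, μ)` the weight is exactly `K · K^{-d}` (`μ ≠ ν`). [folklore] -/
theorem blockSum_sqBdry_witness (K : ℕ) (hK : 0 < K) (y : Fin d → ℤ) {μ ν : Fin d} (hμν : μ ≠ ν) :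
    (((K : ℝ) ^ d)⁻¹ • ∑ x ∈ blockSites K y, sqBdry K x μ ν) (blockBase K y + Pi.single μ ((K : ℤ) - 1), μ) =
      (K : ℝ) * ((K : ℝ) ^ d)⁻¹ := by
  haveI : NeZero K := ⟨hK.ne'⟩
  set b : ZdEdge d := (blockBase K y + Pi.single μ ((K : ℤ) - 1), μ) with hb
  rw [Pi.smul_apply, smul_eq_mul, mul_comm]
  congr 1
  have split : (∑ x ∈ blockSites K y, sqBdry K x μ ν) b =
      (∑ x ∈ blockSites K y, seg K (x + 0) μ) b + (∑ x ∈ blockSites K y, seg K (x + Pi.single μ (K : ℤ)) ν) b -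
        (∑ x ∈ blockSites K y, seg K (x + Pi.single ν (K : ℤ)) μ) b - (∑ x ∈ blockSites K y, seg K (x + 0) ν) b := by
    simp only [sqBdry_eq, rectBdry, add_zero, Finset.sum_apply, Pi.add_apply, Pi.sub_apply,
      Finset.sum_add_distrib, Finset.sum_sub_distrib]
  rw [split, sum_seg_apply, sum_seg_apply, sum_seg_apply, sum_seg_apply]
  have hb2 : b.2 = μ := rfl
  have hb1 : b.1 = blockBase K y + Pi.single μ ((K : ℤ) - 1) := rfl
  -- bottom: all `K` positions hit
  have bottom : ∑ l ∈ range K,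
      (if b.2 = μ ∧ b.1 - 0 - Pi.single μ (l : ℤ) ∈ blockSites K y then (1 : ℝ) else 0) = K := by
    rw [Finset.sum_eq_card_nsmul (b := (1 : ℝ))]
    · simp
    intro l hl
    rw [Finset.mem_range] at hl
    rw [if_pos]
    refine ⟨hb2, ?_⟩
    rw [hb1, sub_zero, add_sub_assoc, ← Pi.single_sub, mem_blockSites_iff]
    refine blockMap_blockBase_add_of_lt K y _ (fun i => ?_) (fun i => ?_)
    · by_cases hi : i = μ
      · subst hi; simp; omega
      · simp [Pi.single_eq_of_ne hi]
    · by_cases hi : i = μ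
      · subst hi; simp; omega
      · simp [Pi.single_eq_of_ne hi]; exact hK
  -- top: none (`⌊b_ν/K⌋ = y_ν`, not `y_ν + 1`)
  have top : ∑ l ∈ range K,
      (if b.2 = μ ∧ b.1 - Pi.single ν (K : ℤ) - Pi.single μ (l : ℤ) ∈ blockSites K y then (1 : ℝ) else 0) = 0 := by
    refine Finset.sum_eq_zero fun l _ => ?_
    rw [if_neg]
    rintro ⟨_, h⟩
    have e : b.1 - Pi.single ν (K : ℤ) - Pi.single μ (l : ℤ) =
        b.1 - Pi.single ν ((K : ℤ) * 1) - Pi.single μ (l : ℤ) := by simp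
    have q := blockCoord_of_mem (K := K) hμν 1 (e ▸ h)
    have hK' : (K : ℤ) ≠ 0 := by exact_mod_cast hK.ne'
    rw [hb1] at q
    simp only [Pi.add_apply, Pi.single_eq_of_ne hμν.symm, add_zero, blockBase] at q
    rw [mul_comm, Int.mul_ediv_cancel _ hK'] at q
    omega
  have right : ∑ l ∈ range K,
      (if b.2 = ν ∧ b.1 - Pi.single μ (K : ℤ) - Pi.single ν (l : ℤ) ∈ blockSites K y then (1 : ℝ) else 0) = 0 :=
    Finset.sum_eq_zero fun l _ => by rw [if_neg]; rintro ⟨h, _⟩; exact hμν (hb2.symm.trans h)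
  have left : ∑ l ∈ range K,
      (if b.2 = ν ∧ b.1 - 0 - Pi.single ν (l : ℤ) ∈ blockSites K y then (1 : ℝ) else 0) = 0 :=
    Finset.sum_eq_zero fun l _ => by rw [if_neg]; rintro ⟨h, _⟩; exact hμν (hb2.symm.trans h)
  rw [bottom, top, right, left]
  ring

/-- θ₁(n) EXACTLY (record §4 V1, now for all `d`, `L ≥ 1`, `n`, `μ ≠ ν`): in `w = (pull L)^[n] ∂Sq₁(y)` every fine bond has
`|w_b| ≤ Lⁿ · L^{-nd}` and some bond attains it. [folklore] -/
theorem theta1_exact (L : ℕ) (hL : 0 < L) (n : ℕ) (y : Fin d → ℤ) {μ ν : Fin d} (hμν : μ ≠ ν) :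
    (∀ b, |(pull L)^[n] (sqBdry 1 y μ ν) b| ≤ ((L ^ n : ℕ) : ℝ) * ((((L ^ n : ℕ) : ℝ)) ^ d)⁻¹) ∧
      ∃ b, (pull L)^[n] (sqBdry 1 y μ ν) b = ((L ^ n : ℕ) : ℝ) * ((((L ^ n : ℕ) : ℝ)) ^ d)⁻¹ := by
  rw [loopPull_closed L hL n y μ ν]
  exact ⟨fun b => abs_blockSum_sqBdry_le (L ^ n) (pow_pos hL n) y μ ν b,
    ⟨_, blockSum_sqBdry_witness (L ^ n) (pow_pos hL n) y hμν⟩⟩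

/-- The rate in closed form: `Lⁿ · (Lⁿ)^{-d} = L^{(1−d)n}` — `θ₁ = L^{1−d}` PER LEVEL. [folklore] -/
theorem rate_eq_zpow (L : ℕ) (hL : 0 < L) (n : ℕ) :
    ((L ^ n : ℕ) : ℝ) * ((((L ^ n : ℕ) : ℝ)) ^ d)⁻¹ = (L : ℝ) ^ ((1 - (d : ℤ)) * n) := by
  have hLr : (L : ℝ) ≠ 0 := by exact_mod_cast hL.ne'
  push_cast
  rw [← zpow_natCast, ← zpow_natCast, ← zpow_neg, ← zpow_mul, ← zpow_add₀ hLr]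
  congr 1
  ring

end Literature.MathematicalPhysics.QuantumFieldTheory.Balaban1983to89.T4LoopPullback
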